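import Summits.ResolutionOfSingularities.ResolutionOfSingularities.Theorems.PurelyInseparableDim4ResConeLossFreeConstant
import Summits.ResolutionOfSingularities.ResolutionOfSingularities.Theorems.PurelyInseparableDim4ResConeKeepBudget
import HarnessLib
import HarnessLib.Audit.Tags

/-!
# Purely inseparable four-folds — A LOSS-FREE TAIL FREEZES WITH AT LEAST TWO ACTIVE TWINS, every `(p, d)`, any `e_G`
# (K2(p) lane, rows B-LF: the END STATE of the loss-free corner game; cell `res-dim4-pi`)

[OURS · counted 0 · cell `res-dim4-pi` · K2(p) lane holder res-dim4-p-12 g5, S4 rows B-LF (i)/(ii); seat res-dim4-p-2 g6, sequel of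
`…ResConeLossFreeConstant` (p715775).]  Nothing here proves any TAIL(p, d, e), K2(7), K2(p) or resolution of singularities in dimension ≥ 4 /
characteristic `p` — NOT proved; a structure theorem about OUR frame's chains.  AI kernel work, weaker than expert review.

`lossfree_weights_eventually_constant` freezes the weights of a loss-free constant-shade tail from some `K₁`; this file adds the free-tail
theorem FT (`no_tail_of_eventually_free`, res-dim4-p-7 g3): on a loss-free tail a step is FREE iff it re-charts the letter just born
(translating it would be a loss), so FT gives chart CHANGES beyond every time; since every late chart hits a letter of the newborn weight
`n = |r| + d − p` (`lossfree_charted_weight`) and the weights are frozen, the frozen state carries AT LEAST TWO letters of weight `n`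
(«active twins»), and every letter charted late is one of weight `n`:
* **`chart_change_after`** — beyond every time a step changes the chart letter (weak FT);
* **`lossfree_frozen_twins`** — `∃ K₁ ≥ k₀`, weights constant from `K₁`, every late chart letter has weight `|r_{K₁}| + d − p` in the frozen
  state, and two distinct letters of that weight exist.
With `(k − 1)·n + W = p − d` (`n` = common active weight, `k ≥ 2` active letters, `W` the passive weight; immediate from `n = |r| − (p − d)`)
these are the «light multi-twin + passive» end states of the holder's rows B-LF — at `p = 7`: `(1,1)@(7,6) · (2,2),(1,1,1)@(7,5) ·
(2,1,1),(2,2,1),(1,1,1,1)@(7,4) · (2,2,1,1),(2,1,1,1),(3,1,1),(2,2,2)@(7,3)` (ledger census `auto-g6/lossfree.py`).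
[cite: CossartJannsenSaito2020, Thm. 3.14, Lemma 13.2] [cite: HauserPerlega2019PRIMS, §2 (transform D' of D)]
bears_on: LADDER-RESOLUTION:D157-DOOR2 (res-dim4-pi · K2(p) · rows B-LF · loss-free end state = frozen twins).
Supports stmt-ResolutionOfSingularities-16155 (helper).
-/

set_option linter.dupNamespace false -- mandated namespace of this single-conjunct summit

noncomputable section

namespace Summit.ResolutionOfSingularities.ResolutionOfSingularities.Theorems.PIDim4

namespace ResCone

open MvPolynomial Finset IsLocalRing
open Literature.AlgebraicGeometry.Resolution
open Literature.AlgebraicGeometry.Resolution.CentreBlowup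
open Literature.AlgebraicGeometry.Resolution.Hauser2010
open Literature.AlgebraicGeometry.Resolution.HauserPerlega2019

variable {K : Type} [Field K] {p : ℕ} [Fact p.Prime] [CharP K p] [DecidableEq K]

/-- **The chart letter changes beyond every time** (a weak form of FT): a step that re-charts the letter just born is FREE, and
`no_tail_of_eventually_free` forbids an eventually free tail — in particular an eventually constant chart. [OURS]
[cite: CossartJannsenSaito2020, Thm. 3.14] -/
theorem chart_change_after {c : ℕ → State K} {j : ℕ → Fin 4} {b : ℕ → Fin 4 → K}
    (hc : ∀ k, IsIsolated p (c k).F ∧ Step0 p (c k) (c (k + 1))) (hw : FreeTail.IsWitnessedChain p c j b) (N : ℕ) :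
    ∃ k, N ≤ k ∧ j (k + 1) ≠ j k := by
  by_contra hno
  push Not at hno
  exact no_tail_of_eventually_free p hc hw (k₁ := N) fun k hk => Or.inl (hno k hk)

/-- **A LOSS-FREE TAIL FREEZES WITH AT LEAST TWO ACTIVE TWINS, every `(p, d)`, any `e_G`.**  Along a witnessed isolated above-floor
`Step0 p` chain with `x^{r₀} ∣ F₀`, constant shade `d` from `k₀`, loss-free from `k₀`: there is `K₁ ≥ k₀` from which on the weights are
CONSTANT, every charted letter has the weight `n := |r_{K₁}| + d − p` in the frozen state, and the frozen state has two DISTINCT letters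
of weight `n`.  (`lossfree_weights_eventually_constant` + `lossfree_charted_weight` + `chart_change_after`.) [OURS]
[cite: CossartJannsenSaito2020, Thm. 3.14, Lemma 13.2] -/
theorem lossfree_frozen_twins {c : ℕ → State K} {j : ℕ → Fin 4} {b : ℕ → Fin 4 → K}
    (hc : ∀ k, IsIsolated p (c k).F ∧ Step0 p (c k) (c (k + 1))) (hw : FreeTail.IsWitnessedChain p c j b)
    (hr0 : ∀ e ∈ (c 0).F.support, (c 0).r ≤ e) (hfloor : ∀ k, ordZero (c k).F ≠ p) {k₀ d : ℕ}
    (hshade : ∀ k, k₀ ≤ k → (c k).shade = ((d : ℕ) : ℕ∞))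
    (hloss : ∀ k, k₀ ≤ k → ∀ i, b k i ≠ 0 → (c k).r i = 0) :
    ∃ K₁, k₀ ≤ K₁ ∧ (∀ k, K₁ ≤ k → (c k).r = (c K₁).r) ∧
      (∀ k, K₁ ≤ k → (c K₁).r (j k) = (c K₁).r.degree + d - p) ∧
      ∃ a a' : Fin 4, a ≠ a' ∧ (c K₁).r a = (c K₁).r.degree + d - p ∧ (c K₁).r a' = (c K₁).r.degree + d - p := by
  obtain ⟨K₁, hK₁, hlate⟩ := lossfree_charted_weight hc hw hr0 hfloor hshade hloss
  -- constant weights from `K₁`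
  have hconst : ∀ k, K₁ ≤ k → (c k).r = (c K₁).r := by
    intro k hk
    obtain ⟨m, rfl⟩ := Nat.exists_eq_add_of_le hk
    induction m with
    | zero => rfl
    | succ m ih =>
      rw [show K₁ + (m + 1) = K₁ + m + 1 by ring, (hlate (K₁ + m) (Nat.le_add_right _ _)).1]
      exact ih (Nat.le_add_right _ _)
  have hchart : ∀ k, K₁ ≤ k → (c K₁).r (j k) = (c K₁).r.degree + d - p := by
    intro k hk
    have h := (hlate k hk).2
    rwa [hconst k hk] at h
  refine ⟨K₁, hK₁, hconst, hchart, ?_⟩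
  -- a late chart change gives two distinct charted letters, both of the frozen newborn weight
  obtain ⟨k, hk, hne⟩ := chart_change_after hc hw K₁
  exact ⟨j (k + 1), j k, hne, hchart (k + 1) (by omega), hchart k hk⟩

end ResCone

end Summit.ResolutionOfSingularities.ResolutionOfSingularities.Theorems.PIDim4

end
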